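import Summits.AnomalousDissipation.AnomalousDissipation.Theorems.SolenoidalFractalHomogenisationLagrangianStepD1SplitR
import HarnessLib

/-!
# K1L_D `LagrangianRenormalisationStepDesign` (stmt-AnomalousDissipation-27980), `stub_D1_V0R` (ruling D27-1; V0 = clause (ii) of
# `WCrossing.D1ExactFamily`), brick T8a: THE RESIDUE HYPOTHESIS OF `stub_D1_V0R` GIVES A QUANTITATIVE LOWER BOUND FOR THE TRANSVERSE SYMBOL OF `psiStar`
# on the guarded (V)-window: `symb (psiStar ν S) k p ≥ (1 − ρB)·0.97·gainForm W₀ MB (11/10) k p/(11/10)`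
# (helper; `--kind proof --supports stmt-AnomalousDissipation-27980 --as helper`)

Summits-side helper file of route `SolenoidalFractalHomogenisation` (prover seat `ad-k1l-cellLawV-w1` g7; 0 sorry, no defs, no named facts).  This is where
the D27-1 hypothesis of `stub_D1_V0R` (the registered `stub_D1_residue` text: `RelSmall (ΨB₁ a ν S − ΦB a S) (ΦB a S) ρB` on the block window,
sectors `τ ≤ 1/20`, `ν ∈ (0, νB₁]`) is consumed (cell finding F-w1g7-1: the coercivity `c₀` of the averaged slow generator).  Chain: `RelSmall.transLE`
(`(1−ρ)•Φ ≼ Φ + (Ψ − Φ) = Ψ`, `transNonneg_ΦB`) ⇒ `a·symb psiStar ≥ (1−ρB)·a·symb (excQS W₀ MB S)`; `OddGain.evenPinch_excQS_design_point'`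
⇒ `symb (excQS W₀ MB S) ≥ 0.97·gainForm W₀ MB (11/10)/(11/10)`; on the guarded (V)-window `window_in_sector` (`…D1SplitR`) supplies the block window and
the sector.  The remaining input for `c₀|k|²|p|²` is a lower bound `gainForm W₀ MB (11/10) k p ≥ c_gain·|k|²·|p|²` (`p ⊥ k`) — isotropy of the cubature
word (`isotropicWordGain_cubatureWord`) + `le_slotWeight_half` (`slotRelax_ge_thirty`); NOT in this file.
* `symb_psiStar_ge_of_residue` — block-window form; * `symb_psiStar_ge_of_residue_window` — guarded (V)-window form (`S = (1/ν)•𝔸`-ready).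
NOT a proof of any registered stub, of K1L_D, or of anomalous dissipation; rung F-D1.A0 infrastructure.
-/

set_option linter.dupNamespace false

noncomputable section

namespace Summit.AnomalousDissipation.AnomalousDissipation.Theorems.SolenoidalFractalHomogenisation.LagrangianStep.Sideband

open Set
open Summit.AnomalousDissipation.AnomalousDissipation.Theorems
open Summit.AnomalousDissipation.AnomalousDissipation.Theorems.SolenoidalFractalHomogenisation.LagrangianStep
open Summit.AnomalousDissipation.AnomalousDissipation.Theorems.SolenoidalFractalHomogenisation.LagrangianStep.WCrossing
open Literature.Analysis Literature.Analysis.FluidPDE Literature.Analysis.FunctionSpaces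

/-- **LOWER BOUND FOR THE SYMBOL OF `psiStar` FROM THE RESIDUE (block-window form).**  If, for the normalisation `a > 0`, the residue bound
`RelSmall (ΨB₁ a ν S − ΦB a S) (ΦB a S) ρB` holds at `ν` on the block window, then for `NearIso S (10/11) (11/10)`, `OddSectorial S τ`, `τ ≤ 1/20`
and every transverse pair `p ⊥ k`:  `(1 − ρB)·(97/100)·gainForm W₀ MB (11/10) k p/(11/10) ≤ symb (psiStar W₀ MB ν S) k p`.
[cite: MajdaKramer1999, §2.2.1.3 (55) (effective diffusivity)] [cite: ArmstrongVicol2025, §3 (renormalised diffusivity of one level)] -/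
theorem symb_psiStar_ge_of_residue {a ν : ℝ} (ha : 0 < a) {S : T4}
    (hres : ∀ τ ∈ Set.Icc (0:ℝ) (1 / 20), OddSectorial S τ → RelSmall (ΨB₁ a ν S - ΦB a S) (ΦB a S) ρB)
    (hS : Torus.NearIso S (10 / 11) (11 / 10)) {τ : ℝ} (hτ : τ ∈ Set.Icc (0:ℝ) (1 / 20)) (hodd : OddSectorial S τ)
    (k p : Fin 3 → ℝ) (hkp : ∑ i, p i * k i = 0) :
    (1 - ρB) * (97 / 100 * (gainForm cubatureWord MB (11 / 10) k p / (11 / 10))) ≤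
      Torus.symb (Sideband.psiStar cubatureWord MB MB_pos ν S) k p := by
  have hR := hres τ hτ hodd
  have hΦ : TransNonneg (ΦB a S) := transNonneg_ΦB ha.le hS hτ hodd
  have hle := (hR.transLE hΦ ρB_nonneg).1 k p hkp
  rw [add_sub_cancel, Torus.symb_smul] at hle
  -- `symb (ΨB₁ a ν S) = a·symb psiStar`, `symb (ΦB a S) = a·symb (excQS …)`
  have hΨ : Torus.symb (ΨB₁ a ν S) k p = a * Torus.symb (Sideband.psiStar cubatureWord MB MB_pos ν S) k p := by
    unfold ΨB₁; rw [Torus.symb_smul]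
  have hΦB : Torus.symb (ΦB a S) k p = a * Torus.symb (excQS cubatureWord MB S) k p := by
    unfold ΦB; rw [Torus.symb_smul]
  rw [hΨ, hΦB] at hle
  have hpinch := (OddGain.evenPinch_excQS_design_point' (Mlag := MB) (le_of_eq rfl) ⟨hτ.1, hτ.2.trans (by norm_num)⟩ hS hodd k p).1
  have h1ρ : 0 ≤ 1 - ρB := by unfold ρB; norm_num
  -- divide by `a`
  have h2 : (1 - ρB) * Torus.symb (excQS cubatureWord MB S) k p ≤ Torus.symb (Sideband.psiStar cubatureWord MB MB_pos ν S) k p := by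
    have : a * ((1 - ρB) * Torus.symb (excQS cubatureWord MB S) k p) ≤ a * Torus.symb (Sideband.psiStar cubatureWord MB MB_pos ν S) k p := by
      nlinarith [hle]
    exact le_of_mul_le_mul_left this ha
  exact (mul_le_mul_of_nonneg_left hpinch h1ρ).trans h2

/-- **LOWER BOUND FOR THE SYMBOL OF `psiStar` FROM THE RESIDUE, on the GUARDED (V)-window of `stub_D1_V0R`** (D27-1): with the residue hypothesis
for `a > 0` on `(0, νB₁]`, window data `0 < lo ≤ hi`, `hi·ΛV ≤ 11/10`, `(10/11)ΛV ≤ lo`, `0 ≤ β`, `β·ΛV ≤ lo/20`, and `S` with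
`NearIso S (lo/λ) (hi·λ)`, `λ ∈ [1, ΛV]`, `OddSmall S β`:  for every transverse pair `p ⊥ k` and `ν ∈ (0, νB₁]`,
`(1 − ρB)·(97/100)·gainForm W₀ MB (11/10) k p/(11/10) ≤ symb (psiStar W₀ MB ν S) k p`. [cite: MajdaKramer1999, §2.2.1.3 (55)] -/
theorem symb_psiStar_ge_of_residue_window {a : ℝ} (ha : 0 < a)
    (hres : ∀ ν ∈ Set.Ioc 0 νB₁, ∀ S : T4, Torus.NearIso S (10 / 11) (11 / 10) → ∀ τ ∈ Set.Icc (0:ℝ) (1 / 20), OddSectorial S τ →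
      RelSmall (ΨB₁ a ν S - ΦB a S) (ΦB a S) ρB)
    {lo hi ΛV β lam : ℝ} (hlo : 0 < lo) (hlh : lo ≤ hi) (h1 : hi * ΛV ≤ 11 / 10) (h2 : 10 / 11 * ΛV ≤ lo) (hβ0 : 0 ≤ β)
    (hβ : β * ΛV ≤ lo / 20) (hlam : lam ∈ Set.Icc 1 ΛV) {S : T4} (hN : Torus.NearIso S (lo / lam) (hi * lam)) (hO : Torus.OddSmall S β)
    {ν : ℝ} (hν : ν ∈ Set.Ioc 0 νB₁) (k p : Fin 3 → ℝ) (hkp : ∑ i, p i * k i = 0) :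
    (1 - ρB) * (97 / 100 * (gainForm cubatureWord MB (11 / 10) k p / (11 / 10))) ≤
      Torus.symb (Sideband.psiStar cubatureWord MB MB_pos ν S) k p := by
  obtain ⟨hS, τ, hτ, hodd⟩ := window_in_sector hlo hlh h1 h2 hβ0 hβ hlam hN hO
  exact symb_psiStar_ge_of_residue ha (fun τ' hτ' hodd' => hres ν hν S hS τ' hτ' hodd') hS hτ hodd k p hkp

end Summit.AnomalousDissipation.AnomalousDissipation.Theorems.SolenoidalFractalHomogenisation.LagrangianStep.Sideband

end
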